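import Literature.MathematicalPhysics.QuantumFieldTheory.Balaban1983to89.B8Ineq159CurvedCubeMemberPerCubeTower
import Literature.MathematicalPhysics.QuantumFieldTheory.Balaban1983to89.B8Ineq159GaugeCovariance

/-!
# `Balaban1983to89.B8Ineq159GaugeCovarianceTower` — [Balaban1985RegularSpaces] p. 77 (gauge invariance of `𝔄_k`), (1.11) p. 78, (1.59) p. 86: the per-member
# CURVED (1.59) at EVERY TRUNCATION `1 ≤ m ≤ k` ([Balaban1985Averaging] Prop. 2's averaging-closed regime, file (D′)) at every background GAUGE-EQUIVALENT to a
# `δ₀`-close one — the all-truncations twin of `B8Ineq159GaugeCovariance.exists_curved159_perCube_truncOne_gauge` (file (E′))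

statement-level skeleton of published theorems with citation tags; proofs where landed; nothing here is a claim about the
Yang–Mills mass gap

`[Balaban1985RegularSpaces]` ("B8") p. 77, (1.11) p. 78, (1.29) p. 81, (1.38) p. 82, (1.59) p. 86, (1.62) p. 87, (1.131) p. 99; [4] = `[Balaban1985BackgroundPropagators]`
(3.32) p. 395, Thm 3.3 p. 399; [B7] = `[Balaban1985Averaging]` (11) p. 19, (43) p. 24, Prop. 2 (52)–(54) p. 26.

CITATION HEADER (lean-in-tree rule).  Cell `pub-ymgap` (YM Track A, HUMAN RULING D-0062 ∕ D-0149), DAG node N05 = [B8], width seat `pub-ymgap-dag-n05-w3`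
(g2), CLAIM-1 file (E′).  WHY.  File (E) transported the truncation-`1` theorem (D) along gauge transformations; THIS FILE does the same for the all-truncations
theorem (D′) (`B8Ineq159CurvedCubeMemberPerCubeTower.exists_curved159_perCube`), with the SAME transport (every identity of (E) §1–§2 is truncation-generic):
★★ `exists_curved159_perCube_gauge` — for `u` unit-bounded and `V` valued in the averaging-closed `G`, `δ₀(□, m)`-close to `1` bondwise, the conclusion of (D′)
at `U₀ = V^u`.

HONEST SCOPE.  Algebra + (D′) by transport; per member and per truncation, non-explicit constants; `V ∈ G` (averaging-closed) in the `V`-gauge — NOT `𝔄_k(α₀)`;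
NOT a socket inhabitant; NOT [4] Thm 3.3; count-neutral; N05 NOT discharged; no count claim; one finite `𝕋⁴` programme at fixed `ε`, Bałaban as printed; the YM mass
gap (Clay) is NOT proved by any of this — R4 closes the conditional finite-`𝕋⁴` rung `BalabanLadder.UV` only; nothing continuum ∕ ℝ⁴ ∕ OS.  No `sorry`, no `def`,
no `instance`, no `notation`.  Unit `pub-ymgap-dag-n05-w3` (g2), 2026-08-28.
-/

noncomputable section

namespace Literature.MathematicalPhysics.QuantumFieldTheory.Balaban1983to89.B8Ineq159GaugeCovarianceTower

open B7Prop1Explicit B7Prop2Explicit B7Prop1Local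
open B7Eq78Linearization (conjR conjR_apply conjR_smul)
open B7Prop4GeneralLevels (linCovIter)
open B8Ineq132 (covDerivFwd covDeriv BondTouches norm_conjR)
open B8Eq140Level (SideTouches)
open B8Eq146AExpansion (iEta)
open B8Eq155JBound (Jcur)
open B8Eq138LandauZd (IsLandau138 covLap covDivB QT)
open B8Eq131CubesAdmissible (cubeFam)
open B8CubeMemberZd (cubeLamS)
open B8Ineq159FlatCubeMemberPrinted (cubeLamBP)
open B9Eq340HolderZd (covDerivFwd_gaugeAct)
open B9Eq332FieldAvgCovariance (linCovIter_rot)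
open B9Eq332AvgCovariance (conjR_inv_conjR)
open B8Ineq159GaugeCovariance (Jcur_gaugeAct covLap_gaugeAct isLandau138_gaugeAct_iff)
open B8Ineq159CurvedCubeMemberPerCubeTower (exists_curved159_perCube)

export B7Prop1Explicit (Site)

variable {d : ℕ} {𝔸 : Type*} [NormedRing 𝔸] [NormOneClass 𝔸] [NormedAlgebra ℂ 𝔸] [CompleteSpace 𝔸]

/-- ★★ **(1.59) AT A CURVED BACKGROUND ON THE CUBE MEMBER, PER MEMBER, EVERY TRUNCATION `1 ≤ m ≤ k`, FOR EVERY BACKGROUND GAUGE-EQUIVALENT TO A `δ₀`-CLOSE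
`G`-VALUED ONE** (`G` averaging-closed, [B7] Prop. 2).  With the SAME `δ₀(□, m), B′(□, m)` as `exists_curved159_perCube`: for `u` unit-bounded, `V` valued in `G` with
`‖V(b) − 1‖ ≤ δ₀` on all bonds, `U₀ = V^u`: the curved data of a field `φ` in the Landau gauge of `U₀` at truncation `m` dominate `(Lʲη)|φ|, (Lʲη)²|D^η_{U₀}φ|, (Lʲη)³|Δ^η_{U₀}φ|`
on the sides of `□_j`, `j ≤ m`.  PROOF: (E) §4's transport on (D′).  HONEST SCOPE: per member ∕ truncation, non-explicit, not `𝔄_k(α₀)`, not a socket inhabitant.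
[cite: Balaban1985RegularSpaces, (1.59) p.86, p.77, (1.11) p.78, (1.38) p.82, (1.131) p.99; Balaban1985BackgroundPropagators, (3.32) p.395, Thm 3.3 p.399; Balaban1985Averaging, (11) p.19, Prop. 2 (52)–(54) p.26] -/
theorem exists_curved159_perCube_gauge [FiniteDimensional ℂ 𝔸] (hd2 : 2 ≤ d) {L : ℕ} (hL2 : 2 ≤ L) {η : ℝ} (hη : 0 < η)
    {G : Subgroup 𝔸ˣ} (hG : AvgClosed d L G) (a : Site d) (M ρ : ℕ) {k m : ℕ} (hm1 : 1 ≤ m) (hmk : m ≤ k) :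
    ∃ δ₀ B' : ℝ, 0 < δ₀ ∧ 0 < B' ∧ ∀ (u : Site d → 𝔸ˣ), (∀ x, u x ∈ U1 𝔸) →
      ∀ (V : Site d → Fin d → 𝔸ˣ), (∀ x κ, V x κ ∈ G) → (∀ x κ, ‖((V x κ : 𝔸ˣ) : 𝔸) - 1‖ ≤ δ₀) →
      ∀ φ : Site d → Fin d → 𝔸,
        IsLandau138 L m η (cubeFam false L a M ρ k 0) (cubeLamS L a M ρ k m) (gaugeAct u V) φ →
        (∀ (y : Site d) (τ : Fin d), (∀ j, j ≤ m → ¬ SideTouches (cubeFam false L a M ρ k j) y τ) → φ y τ = 0) →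
        ∀ N : ℝ, 0 ≤ N →
          (∀ j, j ≤ m → ∀ (y : Site d) (τ : Fin d), BondTouches (cubeFam false L a M ρ k j) y τ →
              ((L : ℝ) ^ j * η) ^ 3 * ‖Jcur η (gaugeAct u V) φ τ y‖ ≤ N) →
          (∀ j, j ≤ m → ∀ c ∈ cubeLamBP L a M ρ k m j, ‖linCovIter L (gaugeAct u V) (iEta η φ) j c.1 c.2‖ ≤ N) →
          (∀ (y : Site d) (τ : Fin d), ¬ BondTouches (cubeFam false L a M ρ k 0) y τ → η * ‖φ y τ‖ ≤ N) →
          ∀ j, j ≤ m → ∀ (y : Site d) (τ : Fin d), SideTouches (cubeFam false L a M ρ k j) y τ →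
            ((L : ℝ) ^ j * η) * ‖φ y τ‖ ≤ B' * N ∧
            (∀ ν : Fin d, ((L : ℝ) ^ j * η) ^ 2 * ‖covDerivFwd η (gaugeAct u V) ν (fun z => φ z τ) y‖ ≤ B' * N) ∧
            ((L : ℝ) ^ j * η) ^ 3 * ‖covLap η (gaugeAct u V) (fun z => φ z τ) y‖ ≤ B' * N := by
  obtain ⟨δ₀, B', hδ₀, hB', H⟩ := exists_curved159_perCube (𝔸 := 𝔸) hd2 hL2 hη hG a M ρ hm1 hmk
  refine ⟨δ₀, B', hδ₀, hB', ?_⟩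
  intro u hu V hV hδ φ hLan hs N hN h1 h2 h3 j hj y τ hst
  -- the transported field `A = R(u)⁻¹φ`, so that `φ = A^u`
  set A : Site d → Fin d → 𝔸 := fun z κ => conjR (u z)⁻¹ (φ z κ) with hA
  have hφA : φ = fun z κ => conjR (u z) (A z κ) := by
    funext z κ
    rw [hA]
    exact (conjR_inv_conjR (u z)⁻¹ (φ z κ)).symm.trans (by rw [inv_inv])
  have hnA : ∀ z κ, ‖A z κ‖ = ‖φ z κ‖ := fun z κ => by
    rw [hA]; exact norm_conjR ((U1 𝔸).inv_mem (hu z)) _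
  -- hypotheses for `A` at the background `V`
  have hLanA : IsLandau138 L m η (cubeFam false L a M ρ k 0) (cubeLamS L a M ρ k m) V A := by
    rw [hφA] at hLan
    exact (isLandau138_gaugeAct_iff L u V m η _ _ A).1 hLan
  have hsA : ∀ (y : Site d) (τ : Fin d), (∀ j, j ≤ m → ¬ SideTouches (cubeFam false L a M ρ k j) y τ) → A y τ = 0 := by
    intro y' τ' h
    rw [hA]
    show conjR (u y')⁻¹ (φ y' τ') = 0
    rw [hs y' τ' h, conjR_apply, mul_zero, zero_mul]
  have h1A : ∀ j, j ≤ m → ∀ (y : Site d) (τ : Fin d), BondTouches (cubeFam false L a M ρ k j) y τ →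
      ((L : ℝ) ^ j * η) ^ 3 * ‖Jcur η V A τ y‖ ≤ N := by
    intro j' hj' y' τ' hbt
    have e : ‖Jcur η (gaugeAct u V) φ τ' y'‖ = ‖Jcur η V A τ' y'‖ := by
      rw [hφA, Jcur_gaugeAct]; exact norm_conjR (hu y') _
    rw [← e]; exact h1 j' hj' y' τ' hbt
  have h2A : ∀ j, j ≤ m → ∀ c ∈ cubeLamBP L a M ρ k m j, ‖linCovIter L V (iEta η A) j c.1 c.2‖ ≤ N := by
    intro j' hj' c hc
    have hi : iEta η φ = fun z κ => conjR (u z) (iEta η A z κ) := by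
      funext z κ
      rw [hφA]
      simp only [B8Eq146AExpansion.iEta_def, conjR_smul]
    have e : ‖linCovIter L (gaugeAct u V) (iEta η φ) j' c.1 c.2‖ = ‖linCovIter L V (iEta η A) j' c.1 c.2‖ := by
      rw [hi, linCovIter_rot]
      exact norm_conjR (hu _) _
    rw [← e]; exact h2 j' hj' c hc
  have h3A : ∀ (y : Site d) (τ : Fin d), ¬ BondTouches (cubeFam false L a M ρ k 0) y τ → η * ‖A y τ‖ ≤ N := by
    intro y' τ' h; rw [hnA]; exact h3 y' τ' h
  -- file (D) at `V`, transported back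
  obtain ⟨t1, t2, t3⟩ := H V hV hδ A hLanA hsA N hN h1A h2A h3A j hj y τ hst
  refine ⟨by rw [← hnA]; exact t1, fun ν => ?_, ?_⟩
  · have e : ‖covDerivFwd η (gaugeAct u V) ν (fun z => φ z τ) y‖ = ‖covDerivFwd η V ν (fun z => A z τ) y‖ := by
      rw [covDerivFwd_gaugeAct η u V ν (F := fun z => A z τ) (fun z => by rw [hφA])]
      exact norm_conjR (hu y) _
    rw [e]; exact t2 ν
  · have e : ‖covLap η (gaugeAct u V) (fun z => φ z τ) y‖ = ‖covLap η V (fun z => A z τ) y‖ := by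
      have hfun : (fun z => φ z τ) = fun z => conjR (u z) (A z τ) := by funext z; rw [hφA]
      rw [hfun, covLap_gaugeAct]
      exact norm_conjR (hu y) _
    rw [e]; exact t3


end Literature.MathematicalPhysics.QuantumFieldTheory.Balaban1983to89.B8Ineq159GaugeCovarianceTower

end
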